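import Literature.MathematicalPhysics.QuantumFieldTheory.Balaban1983to89.B9Thm313WholeDvHolderAtPins

/-!
# `Balaban1983to89.B9GradViaDivLettersAtPinsHolderEps` — [B9] (3.3) p. 390 ∕ (3.40) p. 397 ∕ (3.44) p. 398: THE HÖLDER LETTER OF `J_μ(U)` AND THE MEMBER
# `Thm33G0DivR.h44DsDv ε` FOR EVERY EXPONENT `ε ≥ 0` (the structure field quantifies `∀ ε > 0`; the g18 files covered `0 < ε ≤ 1`) — the jump
# weight `2^ε` kept symbolic, nothing else changed

T. Bałaban, *Propagators for lattice gauge theories in a background field*, Commun. Math. Phys. **99** (1985) 389–434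
[`Balaban1985BackgroundPropagators`, "B9"]; [4] = T. Bałaban, *Propagators and renormalization transformations for lattice gauge
theories. II*, Commun. Math. Phys. **96** (1984) 223–250 [`Balaban1984PropagatorsII`].

statement-level skeleton of published theorems with citation tags; proofs where landed; nothing here is a claim about the Yang–Mills
mass gap

THE POINT (LOCATED U5 of this seat).  `B9Thm312WholeRightStepFrom3131.Thm33G0DivR` quantifies its fields `h44Ds ∕ h44DsDv` over EVERY `ε > 0` (print's (3.44) is
`0 < ε ≤ 1`), and n06-w5's `B9Thm33G0DivRFromDir.thm33G0DivR_of_dir` builds that record with `h44DsDv` as a hypothesis FOR EVERY ε > 0.  The only place the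
g18 letter `B9GradViaDivLettersAtPinsHolder.hasMaj_JcoKH_holder` used `ε ≤ 1` was the jump weight `2^ε ≤ 2`; the site input class `bHS ε` is NOT monotone in ε
(the torus side is `M·L^k·P_μ > L^k`, so pairs farther than one physical unit have `wS ε < 1` decreasing in ε), hence no reduction to ε = 1 by source domination.
THIS FILE repeats the three steps with `2^ε` symbolic: ★ `tpar_rpow_neg_le_rpow_two_mul_wS` (`t^{−ε} ≤ 2^ε·wS(z,w)`), ★ `holK_JcoKH_le_eps`
(`holK ≤ cR39·(2ϑ·supS + 2^ε·holS)`), ★★ `hasMaj_JcoKH_holder_eps` (kernel `(1 + 2ϑ + 2^ε)·cR39·e^{δ·rJ}·e^{−δd}`, every `ε ≥ 0`, every `δ ≥ 0`), ★★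
`hasMaj_JcoKH_holder_eps_pins`, and ★★ `h44DsDv_eps_pins` — `Thm33G0DivR.h44DsDv ε` at the certificate's pins for EVERY `ε ≥ 0` (so `thm33G0DivR_of_dir` is fed
verbatim by n06-w5's `h44Ds_pins … μ ε` + this, `B_dD(ε) ≥ (d+1)·B_iD(ε)·(1 + 2ϑ + 2^ε)·cR39·e^{δ_J rJ}·c`).  The binder `hΘ` is ε-indexed as before
(`t^{−ε}‖U_μ(s) − U_μ(s′)‖ ≤ ϑ`; inside one cube's small-field gauge it holds with `ϑ = O((d+1)cMα₀L^{−j(2−ε)})` for `ε ≤ 2`).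

HONEST SCOPE.  Verbatim generalization of landed proofs (p620394 ∕ p620780 ∕ p622451); `ϑ` a HYPOTHESIS on `U` (small-gauge position); nothing of [B9]'s
estimates asserted; COUNT-NEUTRAL; N06 NOT discharged; nothing continuum ∕ mass gap.  Cell `pub-ymgap` (D-0062), N06 [B9], rows 20–21, seat `pub-ymgap-dag-n06-l` (g18).
-/

noncomputable section

namespace Literature.MathematicalPhysics.QuantumFieldTheory.Balaban1983to89.B9GradViaDivLettersAtPinsHolderEps

open Node00 B6GlobalChartV1 B6KLevelCensusIndexV1 B9BackgroundsKLevelV1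
open B9Eq39Adjoint (R R_zero R_neg R_inv_R R_add R_smul)
open Node00.OpsYNablaBridge (chartY shiftY_chartY chartY_eq)
open B9CoReadingCoords (XBK coordOpK assembleK blkBK cdsBₗ)
open B9CoReadingCoordsH (coordOpKH coordOpKH_apply)
open B9CoReadingCoordsS (XSK blkSK sIK)
open B9CoReadingCoordsInput (restrK supK holK bHK supK_nonneg holK_nonneg holK_term_nonneg)
open B9CoReadingCoordsInputS (restrS supS holS bHS supS_nonneg holS_nonneg)
open B9CoReadingCoordsHolderS (wS wS_nonneg)
open B9CoRealizesRelAtLetters (RelB relB_refl)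
open LatticeFieldCalculus (supDist)
open B6Geom246MultiLevelTorus (geomT)
open B6Ineq2142KLevelV1 (β lvl)
open B9GeoNormsKLevelV1 (geo9K blkV1_level_le)
open B9Thm39ReadingCoords (cR39 cR39_nonneg coordBound39 basisBound39 abs_repr_le norm_sum_smul_basis_le)
open B9Thm34Ext (toB6)
open B9SectDSup (weightNorm)
open B11SectG (HasMaj BlockNorm)
open B9Thm312Whole (cNorm wt wt_nonneg GeoOK)
open B4TorusKernel.MultiPeriod (torusSupNorm)
open B6Prop22KLevelTorusCensusEta (nKT nKT_pos)
open B9GradViaDivLettersAtPins (Jb Jb_apply JcoKH JcoKH_apply rJ dist_bI_sIK_shift_le supDist_shift_le_one abs_JcoKH_apply_le DvcoKH_eq_sum)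

variable {𝔸 : Type} [NormedRing 𝔸] [NormedAlgebra ℂ 𝔸] [CompleteSpace 𝔸]
variable {d ℓ : ℕ} {hd : 1 ≤ d + 1} {hL : Odd (ℓ + 1) ∧ 1 < ℓ + 1} {b₀ b₁ : ℝ}
variable (i : KIdx d ℓ hd hL b₀ b₁)
variable {κ : Type} [Fintype κ]
open B9GradViaDivLettersAtPinsHolderPairs

/-! ## §1 The jump weight for every `ε ≥ 0` -/

section Dist

omit [CompleteSpace 𝔸] in
/-- **THE JUMP WEIGHT, EVERY `ε ≥ 0`**: for `s ≠ s′` and a charted site `w ≠ z` within `2|s − s′|_∞` of `z`, `t(⟨s,μ⟩,⟨s′,μ⟩)^{−ε} ≤ 2^ε·wS ε z w`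
(`(L^{j(s)}∕|s−s′|)^ε ≤ (2L^k∕|z−w|_T)^ε`). [cite: Balaban1985BackgroundPropagators, (3.40)–(3.41) p.397; Balaban1984PropagatorsII, (2.137) p.247] -/
theorem tpar_rpow_neg_le_rpow_two_mul_wS {ε : ℝ} (hε : 0 ≤ ε) {s s' : Site (PV d ℓ i.m i.K hd hL) 0} (hne : s ≠ s') (μ : Fin (d + 1))
    {a a' : Site (PV d ℓ i.m i.K hd hL) 0} (hne' : a ≠ a') (hw : (supDist a a' : ℝ) ≤ 2 * (supDist s s' : ℝ)) :
    tpar i ⟨s, μ⟩ ⟨s', μ⟩ ^ (-ε) ≤ (2 : ℝ) ^ ε * wS i ε (chartY i a) (chartY i a') := by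
  rw [wS_chartY, tpar_eq, Real.rpow_neg (by positivity), ← Real.inv_rpow (by positivity), ← Real.inv_rpow (by positivity),
    inv_div, inv_div]
  have hn : (0 : ℝ) < (supDist s s' : ℝ) := by
    have h0 : supDist s s' ≠ 0 := fun h => hne ((B3TorusRadialSums.supDist_eq_zero_iff s s').1 h)
    exact_mod_cast Nat.pos_of_ne_zero h0
  have hn' : (0 : ℝ) < (supDist a a' : ℝ) := by
    have h0 : supDist a a' ≠ 0 := fun h => hne' ((B3TorusRadialSums.supDist_eq_zero_iff a a').1 h)
    exact_mod_cast Nat.pos_of_ne_zero h0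
  have hL1 : (1 : ℝ) ≤ ((ℓ + 1 : ℕ) : ℝ) := by exact_mod_cast Nat.succ_le_succ (Nat.zero_le ℓ)
  have hjk : (((ℓ + 1 : ℕ) : ℝ)) ^ (blkV1 i.hN i.D (⟨s, μ⟩ : FBondY i)).1.1 ≤ (((ℓ + 1 : ℕ) : ℝ)) ^ i.k :=
    pow_le_pow_right₀ hL1 (blkV1_level_le i ⟨s, μ⟩)
  have hk0 : (0 : ℝ) < (((ℓ + 1 : ℕ) : ℝ)) ^ i.k := by positivity
  -- `L^{j(s)} ∕ |s − s′| ≤ 2·L^k ∕ |a − a′|`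
  have hbase : (((ℓ + 1 : ℕ) : ℝ)) ^ (blkV1 i.hN i.D (⟨s, μ⟩ : FBondY i)).1.1 / (supDist s s' : ℝ) ≤
      2 * ((((ℓ + 1 : ℕ) : ℝ)) ^ i.k / (supDist a a' : ℝ)) := by
    rw [mul_div_assoc', div_le_div_iff₀ hn hn']
    calc (((ℓ + 1 : ℕ) : ℝ)) ^ (blkV1 i.hN i.D (⟨s, μ⟩ : FBondY i)).1.1 * (supDist a a' : ℝ)
        ≤ (((ℓ + 1 : ℕ) : ℝ)) ^ i.k * (2 * (supDist s s' : ℝ)) := mul_le_mul hjk hw hn'.le hk0.le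
      _ = 2 * (((ℓ + 1 : ℕ) : ℝ)) ^ i.k * (supDist s s' : ℝ) := by ring
  have hpos : 0 ≤ (((ℓ + 1 : ℕ) : ℝ)) ^ i.k / (supDist a a' : ℝ) := by positivity
  calc ((((ℓ + 1 : ℕ) : ℝ)) ^ (blkV1 i.hN i.D (⟨s, μ⟩ : FBondY i)).1.1 / (supDist s s' : ℝ)) ^ ε
      ≤ (2 * ((((ℓ + 1 : ℕ) : ℝ)) ^ i.k / (supDist a a' : ℝ))) ^ ε := Real.rpow_le_rpow (by positivity) hbase hε
    _ = (2 : ℝ) ^ ε * ((((ℓ + 1 : ℕ) : ℝ)) ^ i.k / (supDist a a' : ℝ)) ^ ε := Real.mul_rpow (by norm_num) hpos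

end Dist

/-! ## §2 The ξ-Hölder part and the Hölder majorant of `J_μ(U)`, every `ε ≥ 0` -/

section Holder

variable (b : Module.Basis κ ℝ 𝔸) [FiniteDimensional ℝ 𝔸] (B : B9.Backgrounds) (cfg : B.Cfg → CfgY 𝔸 i)
variable [DecidableRel (RelB i)] {bI : FBondY i → IBondY i}

/-- ★ **THE ξ-HÖLDER PART OF `J_μλ` ON A CLASS, EVERY `ε ≥ 0`** (`holK_JcoKH_le` with the jump weight `2^ε` symbolic): `holK ε y (J_μλ) ≤ cR39·(2ϑ·supS y′ λ + 2^ε·holS ε y′ λ)`.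
[cite: Balaban1985BackgroundPropagators, (3.3) p.390 + (3.35) p.396 + (3.40)–(3.41) p.397 + (3.44) p.398; Balaban1984PropagatorsII, (2.137) p.247] -/
theorem holK_JcoKH_le_eps (hbI0 : ∀ f : FBondY i, bI f = bI ⟨f.src, 0⟩) {U₁ : B.Cfg}
    (hU : ∀ (ν : Fin (d + 1)) (s : Site (PV d ℓ i.m i.K hd hL) 0), ‖(cfg U₁ ν s : 𝔸)‖ ≤ 1 ∧ ‖(((cfg U₁ ν s)⁻¹ : 𝔸ˣ) : 𝔸)‖ ≤ 1)
    {ε : ℝ} (hε : 0 ≤ ε) {ϑ : ℝ} (hϑ : 0 ≤ ϑ)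
    (hΘ : ∀ (μ : Fin (d + 1)) (s s' : Site (PV d ℓ i.m i.K hd hL) 0), Adm i ⟨s, μ⟩ ⟨s', μ⟩ →
      tpar i ⟨s, μ⟩ ⟨s', μ⟩ ^ (-ε) * ‖(cfg U₁ μ s : 𝔸) - (cfg U₁ μ s' : 𝔸)‖ ≤ ϑ)
    (μ : Fin (d + 1)) {y' : IBondY i} {lam : XSK κ i → ℝ} (hloc : ∀ p : XSK κ i, ¬ RelB i (sIK i bI p.1) y' → lam p = 0)
    (y : IBondY i) :
    holK i bI ε y (JcoKH i b B cfg μ U₁ lam) ≤ cR39 b * (2 * ϑ * supS i (sIK i bI) y' lam + (2 : ℝ) ^ ε * holS i (sIK i bI) ε y' lam) := by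
  set J := JcoKH i b B cfg μ U₁ with hJ
  set S : ℝ := supS i (sIK i bI) y' lam with hS
  set H : ℝ := holS i (sIK i bI) ε y' lam with hH
  have hS0 : 0 ≤ S := supS_nonneg i _ y' lam
  have hH0 : 0 ≤ H := holS_nonneg i _ ε y' lam
  have hcR := cR39_nonneg b
  have hcb : 0 ≤ coordBound39 b := norm_nonneg _
  have hbb : 0 ≤ basisBound39 b := Finset.sum_nonneg fun _ _ => norm_nonneg _
  have h2ε : (1 : ℝ) ≤ (2 : ℝ) ^ ε := Real.one_le_rpow (by norm_num) hε
  have h2ε0 : (0 : ℝ) ≤ (2 : ℝ) ^ ε := le_trans zero_le_one h2ε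
  have hM0 : 0 ≤ cR39 b * (2 * ϑ * S + (2 : ℝ) ^ ε * H) := by positivity
  have hM1 : cR39 b * (2 * ϑ * S + H) ≤ cR39 b * (2 * ϑ * S + (2 : ℝ) ^ ε * H) :=
    mul_le_mul_of_nonneg_left (by nlinarith) hcR
  have hM2 : cR39 b * ((2 : ℝ) ^ ε * H) ≤ cR39 b * (2 * ϑ * S + (2 : ℝ) ^ ε * H) := mul_le_mul_of_nonneg_left (by nlinarith) hcR
  refine Real.iSup_le (fun q => ?_) hM0
  obtain ⟨⟨⟨x, dx⟩, ⟨x', dx'⟩⟩, s⟩ := q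
  dsimp only
  split_ifs with hq
  swap
  · exact hM0
  obtain ⟨hadm, hrel⟩ := hq
  have hdir : dx = dx' := hadm.1
  subst hdir
  have hw0 : 0 ≤ tpar i ⟨x, dx⟩ ⟨x', dx⟩ ^ (-ε) := Real.rpow_nonneg (tpar_nonneg i _ _) _
  by_cases hμ : dx = μ
  swap
  · -- another direction: `J_μλ` vanishes at both bonds
    have h1 : J lam (⟨x, dx⟩, s) = 0 := JcoKH_apply_of_dir_ne i b B cfg μ U₁ lam (p := (⟨x, dx⟩, s)) hμ
    have h2 : J lam (⟨x', dx⟩, s) = 0 := JcoKH_apply_of_dir_ne i b B cfg μ U₁ lam (p := (⟨x', dx⟩, s)) hμ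
    simp only [restrK, h1, h2, ite_self, sub_zero, abs_zero, mul_zero]
    exact hM0
  subst hμ
  by_cases hxx : x = x'
  · subst hxx
    rw [sub_self, abs_zero, mul_zero]
    exact hM0
  -- the read sites
  set z : SiteY i := chartY i (x.shift dx) with hz
  set z' : SiteY i := chartY i (x'.shift dx) with hz'
  have hrK : restrK i bI y (J lam) (⟨x, dx⟩, s) = J lam (⟨x, dx⟩, s) := if_pos hrel
  rw [hrK]
  by_cases hrel' : RelB i (bI ⟨x', dx⟩) y
  · -- (A) the partner lies in the class of `y`
    have hrK' : restrK i bI y (J lam) (⟨x', dx⟩, s) = J lam (⟨x', dx⟩, s) := if_pos hrel'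
    rw [hrK']
    have hD := abs_JcoKH_sub_le i b B cfg dx U₁ hU lam x x' s
    have hΘ' := hΘ dx x x' hadm
    have hzz : z ≠ z' := fun h => hxx (shift_injective' i ((chartY i).injective h))
    have hwS : tpar i ⟨x, dx⟩ ⟨x', dx⟩ ^ (-ε) ≤ wS i ε z z' := tpar_rpow_neg_le_wS_shift i hε hxx dx dx
    have hdiff : ∀ a, tpar i ⟨x, dx⟩ ⟨x', dx⟩ ^ (-ε) * |lam (z, s.1, a, s.2.2) - lam (z', s.1, a, s.2.2)| ≤ H := by
      intro a
      calc tpar i ⟨x, dx⟩ ⟨x', dx⟩ ^ (-ε) * |lam (z, s.1, a, s.2.2) - lam (z', s.1, a, s.2.2)|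
          ≤ wS i ε z z' * |lam (z, s.1, a, s.2.2) - lam (z', s.1, a, s.2.2)| := mul_le_mul_of_nonneg_right hwS (abs_nonneg _)
        _ = wS i ε z z' * |lam (z', (s.1, a, s.2.2)) - lam (z, (s.1, a, s.2.2))| := by rw [abs_sub_comm]
        _ ≤ H := wS_mul_abs_sub_le_holS i hloc ε hzz (s.1, a, s.2.2)
    have hsumS := sum_abs_le_card_mul_supS i hloc z s.1 s.2.2
    calc tpar i ⟨x, dx⟩ ⟨x', dx⟩ ^ (-ε) * |J lam (⟨x, dx⟩, s) - J lam (⟨x', dx⟩, s)|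
        ≤ tpar i ⟨x, dx⟩ ⟨x', dx⟩ ^ (-ε) * (coordBound39 b * (2 * ‖(cfg U₁ dx x : 𝔸) - (cfg U₁ dx x' : 𝔸)‖ *
            (basisBound39 b * ∑ a, |lam (z, s.1, a, s.2.2)|) + basisBound39 b * ∑ a, |lam (z, s.1, a, s.2.2) - lam (z', s.1, a, s.2.2)|)) :=
          mul_le_mul_of_nonneg_left hD hw0
      _ = coordBound39 b * (2 * (tpar i ⟨x, dx⟩ ⟨x', dx⟩ ^ (-ε) * ‖(cfg U₁ dx x : 𝔸) - (cfg U₁ dx x' : 𝔸)‖) *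
            (basisBound39 b * ∑ a, |lam (z, s.1, a, s.2.2)|) +
            basisBound39 b * ∑ a, tpar i ⟨x, dx⟩ ⟨x', dx⟩ ^ (-ε) * |lam (z, s.1, a, s.2.2) - lam (z', s.1, a, s.2.2)|) := by
          rw [← Finset.mul_sum]; ring
      _ ≤ coordBound39 b * (2 * ϑ * (basisBound39 b * ((Fintype.card κ : ℝ) * S)) + basisBound39 b * ∑ _a : κ, H) := by
          refine mul_le_mul_of_nonneg_left (add_le_add ?_ ?_) hcb
          · exact mul_le_mul (mul_le_mul_of_nonneg_left hΘ' (by norm_num)) (mul_le_mul_of_nonneg_left hsumS hbb)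
              (by positivity) (by positivity)
          · exact mul_le_mul_of_nonneg_left (Finset.sum_le_sum fun a _ => hdiff a) hbb
      _ = cR39 b * (2 * ϑ * S + H) := by
          rw [Finset.sum_const, Finset.card_univ, nsmul_eq_mul]; simp only [cR39]; ring
      _ ≤ cR39 b * (2 * ϑ * S + (2 : ℝ) ^ ε * H) := hM1
  · -- (B) the partner lies outside the class of `y`: the jump `|J_μλ(b)|`
    have hrK' : restrK i bI y (J lam) (⟨x', dx⟩, s) = 0 := if_neg hrel'
    rw [hrK', sub_zero]
    by_cases hzy : RelB i (sIK i bI z) y'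
    swap
    · rw [JcoKH_apply_eq_zero_of_off i b B cfg dx U₁ hU hloc (p := (⟨x, dx⟩, s)) hzy, abs_zero, mul_zero]
      exact hM0
    -- a partner site among {x, x′} outside the class of `y′`, within `2|x − x′|` of the read site
    have hsx : sIK i bI (chartY i x) = bI ⟨x, dx⟩ := by rw [sIK_chartY, ← hbI0 ⟨x, dx⟩]
    have hsx' : sIK i bI (chartY i x') = bI ⟨x', dx⟩ := by rw [sIK_chartY, ← hbI0 ⟨x', dx⟩]
    obtain ⟨hd1, hd2⟩ := supDist_shift_partner_le i hxx dx
    have key : ∃ w₀ : Site (PV d ℓ i.m i.K hd hL) 0, ¬ RelB i (sIK i bI (chartY i w₀)) y' ∧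
        (supDist (x.shift dx) w₀ : ℝ) ≤ 2 * (supDist x x' : ℝ) := by
      by_cases hxy' : RelB i (bI ⟨x, dx⟩) y'
      · refine ⟨x', ?_, hd2⟩
        rw [hsx']
        intro h'
        exact hrel' (Eq.trans (Eq.trans h' (Eq.symm hxy')) hrel)
      · exact ⟨x, by rw [hsx]; exact hxy', hd1⟩
    obtain ⟨w₀, hw₀, hd₀⟩ := key
    have hne₀ : x.shift dx ≠ w₀ := fun h => hw₀ (by rw [← h]; exact hzy)
    have hzne : z ≠ chartY i w₀ := fun h => hne₀ ((chartY i).injective h)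
    have hw2 : tpar i ⟨x, dx⟩ ⟨x', dx⟩ ^ (-ε) ≤ (2 : ℝ) ^ ε * wS i ε z (chartY i w₀) := tpar_rpow_neg_le_rpow_two_mul_wS i hε hxx dx hne₀ hd₀
    have hjump : ∀ a, tpar i ⟨x, dx⟩ ⟨x', dx⟩ ^ (-ε) * |lam (z, s.1, a, s.2.2)| ≤ (2 : ℝ) ^ ε * H := by
      intro a
      calc tpar i ⟨x, dx⟩ ⟨x', dx⟩ ^ (-ε) * |lam (z, s.1, a, s.2.2)| ≤ ((2 : ℝ) ^ ε * wS i ε z (chartY i w₀)) * |lam (z, s.1, a, s.2.2)| :=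
            mul_le_mul_of_nonneg_right hw2 (abs_nonneg _)
        _ = (2 : ℝ) ^ ε * (wS i ε z (chartY i w₀) * |lam (z, (s.1, a, s.2.2))|) := by ring
        _ ≤ (2 : ℝ) ^ ε * H := mul_le_mul_of_nonneg_left (wS_mul_abs_le_holS_of_off i hloc ε hzne hw₀ (s.1, a, s.2.2)) h2ε0
    calc tpar i ⟨x, dx⟩ ⟨x', dx⟩ ^ (-ε) * |J lam (⟨x, dx⟩, s)|
        ≤ tpar i ⟨x, dx⟩ ⟨x', dx⟩ ^ (-ε) * (coordBound39 b * (basisBound39 b * ∑ a, |lam (z, s.1, a, s.2.2)|)) :=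
          mul_le_mul_of_nonneg_left (abs_JcoKH_apply_le i b B cfg dx U₁ hU lam (⟨x, dx⟩, s)) hw0
      _ = coordBound39 b * (basisBound39 b * ∑ a, tpar i ⟨x, dx⟩ ⟨x', dx⟩ ^ (-ε) * |lam (z, s.1, a, s.2.2)|) := by
          rw [← Finset.mul_sum]; ring
      _ ≤ coordBound39 b * (basisBound39 b * ∑ _a : κ, (2 : ℝ) ^ ε * H) :=
          mul_le_mul_of_nonneg_left (mul_le_mul_of_nonneg_left (Finset.sum_le_sum fun a _ => hjump a) hbb) hcb
      _ = cR39 b * ((2 : ℝ) ^ ε * H) := by rw [Finset.sum_const, Finset.card_univ, nsmul_eq_mul]; simp only [cR39]; ring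
      _ ≤ cR39 b * (2 * ϑ * S + (2 : ℝ) ^ ε * H) := hM2

variable [Fintype (geo9K i).Site]

/-- ★★ **THE HÖLDER MAJORANT OF `J_μ(U)` BETWEEN THE FLAT INPUT NORMS, EVERY `ε ≥ 0`, UNDER THE SMALL-FIELD-GAUGE BINDER** (`hasMaj_JcoKH_holder` with `2^ε` symbolic):
`HasMaj (bHS (sIK bI) ε) (bHK bI ε) (J_μ(U)) ((1 + 2ϑ + 2^ε)·cR39 b·e^{δ·rJ}·e^{−δd})`, every `δ ≥ 0`. [cite: Balaban1985BackgroundPropagators, (3.3) p.390 + (3.35) p.396 + (3.39)–(3.41) p.397 + (3.44) p.398 + p.398 («invariant with respect to gauge transformations»); Balaban1984PropagatorsII, (2.45)–(2.46) p.231 + (2.51)–(2.52) p.232 + (2.137) p.247] -/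
theorem hasMaj_JcoKH_holder_eps
    (hβ1 : ∀ f : FBondY i, (geomT i.D).dist (β i.hN i.D i.hk (bI f)) (blkV1 i.hN i.D f) ≤ 1)
    (hbI0 : ∀ f : FBondY i, bI f = bI ⟨f.src, 0⟩) {U₁ : B.Cfg}
    (hU : ∀ (ν : Fin (d + 1)) (s : Site (PV d ℓ i.m i.K hd hL) 0), ‖(cfg U₁ ν s : 𝔸)‖ ≤ 1 ∧ ‖(((cfg U₁ ν s)⁻¹ : 𝔸ˣ) : 𝔸)‖ ≤ 1)
    {ε : ℝ} (hε : 0 ≤ ε) {ϑ : ℝ} (hϑ : 0 ≤ ϑ)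
    (hΘ : ∀ (μ : Fin (d + 1)) (s s' : Site (PV d ℓ i.m i.K hd hL) 0), Adm i ⟨s, μ⟩ ⟨s', μ⟩ →
      tpar i ⟨s, μ⟩ ⟨s', μ⟩ ^ (-ε) * ‖(cfg U₁ μ s : 𝔸) - (cfg U₁ μ s' : 𝔸)‖ ≤ ϑ)
    {δ : ℝ} (hδ : 0 ≤ δ) {R₀ : ℝ} {H₀ : Prop} (μ : Fin (d + 1)) :
    HasMaj (bHS (R := R₀) (H := H₀) i (sIK i bI) ε) (bHK (R := R₀) (H := H₀) i bI ε) (JcoKH i b B cfg μ U₁)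
      (fun a a' => (1 + 2 * ϑ + (2 : ℝ) ^ ε) * cR39 b * Real.exp (δ * rJ d ℓ) * Real.exp (-(δ * (geo9K i).dist a a'))) := by
  intro y' lam hloc y
  have hloc' : ∀ p : XSK κ i, ¬ RelB i (sIK i bI p.1) y' → lam p = 0 := hloc
  set J := JcoKH i b B cfg μ U₁ with hJ
  set S : ℝ := supS i (sIK i bI) y' lam with hS
  set H : ℝ := holS i (sIK i bI) ε y' lam with hH
  have hS0 : 0 ≤ S := supS_nonneg i _ y' lam
  have hH0 : 0 ≤ H := holS_nonneg i _ ε y' lam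
  have hcR := cR39_nonneg b
  have hcb : 0 ≤ coordBound39 b := norm_nonneg _
  have hbb : 0 ≤ basisBound39 b := Finset.sum_nonneg fun _ _ => norm_nonneg _
  have hE1 := Real.exp_nonneg (δ * rJ d ℓ)
  have hE2 := Real.exp_nonneg (-(δ * (geo9K i).dist y y'))
  show supK i bI y (J lam) + holK i bI ε y (J lam) ≤
    (1 + 2 * ϑ + (2 : ℝ) ^ ε) * cR39 b * Real.exp (δ * rJ d ℓ) * Real.exp (-(δ * (geo9K i).dist y y')) * (S + H)
  have hval : ∀ p : XBK κ i, |J lam p| ≤ cR39 b * S := by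
    intro p
    refine (abs_JcoKH_apply_le i b B cfg μ U₁ hU lam p).trans ?_
    calc coordBound39 b * (basisBound39 b * ∑ a, |lam (chartY i (p.1.src.shift μ), p.2.1, a, p.2.2.2)|)
        ≤ coordBound39 b * (basisBound39 b * ((Fintype.card κ : ℝ) * S)) :=
          mul_le_mul_of_nonneg_left (mul_le_mul_of_nonneg_left (sum_abs_le_card_mul_supS i hloc' _ p.2.1 p.2.2.2) hbb) hcb
      _ = cR39 b * S := by simp only [cR39]; ring
  by_cases hex : ∃ p : XBK κ i, RelB i (bI p.1) y ∧ J lam p ≠ 0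
  swap
  · -- nothing of `J_μλ` is seen from the class of `y`
    have hfar : ∀ p : XBK κ i, RelB i (bI p.1) y → J lam p = 0 := fun p hp => by
      by_contra h
      exact hex ⟨p, hp, h⟩
    have hres : restrK i bI y (J lam) = 0 := by
      funext p
      by_cases hp : RelB i (bI p.1) y
      · simp [restrK, hp, hfar p hp]
      · simp [restrK, hp]
    have h0 : supK i bI y (J lam) + holK i bI ε y (J lam) = 0 := by
      simp only [supK, holK, hres, Pi.zero_apply, abs_zero, sub_zero, mul_zero, ite_self, Real.iSup_const_zero, add_zero]
    rw [h0]
    positivity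
  · -- some bond of the class of `y` reads a site of the class of `y′`: the two classes are within `rJ`
    obtain ⟨p₀, hp₀y, hp₀⟩ := hex
    have hz₀ : RelB i (sIK i bI (chartY i (p₀.1.src.shift μ))) y' := by
      by_contra h
      exact hp₀ (JcoKH_apply_eq_zero_of_off i b B cfg μ U₁ hU hloc' h)
    have hdist : (geo9K i).dist y y' ≤ rJ d ℓ := by
      have e1 : β i.hN i.D i.hk (bI p₀.1) = β i.hN i.D i.hk y := hp₀y
      have e2 : β i.hN i.D i.hk (sIK i bI (chartY i (p₀.1.src.shift μ))) = β i.hN i.D i.hk y' := hz₀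
      show (geomT i.D).dist (β i.hN i.D i.hk y) (β i.hN i.D i.hk y') ≤ rJ d ℓ
      rw [← e1, ← e2]
      exact dist_bI_sIK_shift_le i hβ1 p₀.1.src μ p₀.1.dir
    have h2ε : (1 : ℝ) ≤ (2 : ℝ) ^ ε := Real.one_le_rpow (by norm_num) hε
    have hK : (1 + 2 * ϑ + (2 : ℝ) ^ ε) * cR39 b ≤
        (1 + 2 * ϑ + (2 : ℝ) ^ ε) * cR39 b * Real.exp (δ * rJ d ℓ) * Real.exp (-(δ * (geo9K i).dist y y')) := by
      have h1 : 1 ≤ Real.exp (δ * rJ d ℓ) * Real.exp (-(δ * (geo9K i).dist y y')) := by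
        rw [← Real.exp_add]
        exact Real.one_le_exp (by nlinarith [mul_le_mul_of_nonneg_left hdist hδ])
      have h2 : 0 ≤ (1 + 2 * ϑ + (2 : ℝ) ^ ε) * cR39 b := by positivity
      calc (1 + 2 * ϑ + (2 : ℝ) ^ ε) * cR39 b = (1 + 2 * ϑ + (2 : ℝ) ^ ε) * cR39 b * 1 := (mul_one _).symm
        _ ≤ (1 + 2 * ϑ + (2 : ℝ) ^ ε) * cR39 b * (Real.exp (δ * rJ d ℓ) * Real.exp (-(δ * (geo9K i).dist y y'))) :=
            mul_le_mul_of_nonneg_left h1 h2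
        _ = _ := by ring
    have hsup : supK i bI y (J lam) ≤ cR39 b * S := by
      refine Real.iSup_le (fun p => ?_) (mul_nonneg hcR hS0)
      by_cases hp : RelB i (bI p.1) y
      · simp only [restrK, if_pos hp]; exact hval p
      · simp only [restrK, if_neg hp, abs_zero]; exact mul_nonneg hcR hS0
    have hhol : holK i bI ε y (J lam) ≤ cR39 b * (2 * ϑ * S + (2 : ℝ) ^ ε * H) :=
      holK_JcoKH_le_eps i b B cfg hbI0 hU hε hϑ hΘ μ hloc' y
    calc supK i bI y (J lam) + holK i bI ε y (J lam) ≤ cR39 b * S + cR39 b * (2 * ϑ * S + (2 : ℝ) ^ ε * H) := add_le_add hsup hhol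
      _ = cR39 b * ((1 + 2 * ϑ) * S + (2 : ℝ) ^ ε * H) := by ring
      _ ≤ (1 + 2 * ϑ + (2 : ℝ) ^ ε) * cR39 b * (S + H) := by
          nlinarith [mul_nonneg hcR hS0, mul_nonneg hcR hH0, mul_nonneg (mul_nonneg hcR hϑ) hH0, mul_nonneg (mul_nonneg hcR hS0) (le_trans zero_le_one h2ε),
            mul_nonneg (mul_nonneg hcR hϑ) hS0]
      _ ≤ (1 + 2 * ϑ + (2 : ℝ) ^ ε) * cR39 b * Real.exp (δ * rJ d ℓ) * Real.exp (-(δ * (geo9K i).dist y y')) * (S + H) :=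
          mul_le_mul_of_nonneg_right hK (add_nonneg hS0 hH0)

end Holder

/-! ## §3 At the members: the letter and `Thm33G0DivR.h44DsDv ε` for every `ε ≥ 0` -/

section Members

open scoped Matrix.Norms.L2Operator
open B7Prop2SpecialUnitary (specialUnitaryUnits)
open B9PinMembersKLevelV1 (MemberY geo9Y bg9Y)
open B9CoReadingCoordsTranspose (TrIdx trBasis)
open B9GradViaDivLettersAtPins (cfg_norm_le_one_of_reg335)
open B9CoReadingCoordsH (XHK)
open Node00.OpsYSectDCoords (DvcoKH)
open B9Thm312WholeClasses (cNormR)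
open B9Thm312Whole (Ops)
open B11SectG (RowSum)
open B9Thm313WholeDvHolderFromDds (h44DsDv_of_h44Ds)

variable {Mstar : ℕ} {N : ℕ} [NeZero N]
variable [∀ x : MemberY d ℓ hd hL b₀ b₁ Mstar, Fintype (geo9Y x).Site] [∀ x : MemberY d ℓ hd hL b₀ b₁ Mstar, DecidableRel (RelB x.toKIdx)]

/-- ★★ **THE HÖLDER LETTER `J_μ(U)` AT THE CERTIFICATE'S PINS, EVERY MEMBER, EVERY REGULAR `U` IN SMALL-GAUGE POSITION, EVERY `ε ≥ 0`**.
[cite: Balaban1985BackgroundPropagators, (3.3) p.390 + (3.35) p.396 + (3.39)–(3.41) p.397 + (3.44) p.398; Balaban1984PropagatorsII, (2.51)–(2.52) p.232 + (2.137) p.247] -/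
theorem hasMaj_JcoKH_holder_eps_pins (x : MemberY d ℓ hd hL b₀ b₁ Mstar) {bI : FBondY x.toKIdx → IBondY x.toKIdx}
    (hβ1 : ∀ f : FBondY x.toKIdx, (geomT x.D).dist (β x.hN x.D x.hk (bI f)) (blkV1 x.hN x.D f) ≤ 1)
    (hbI0 : ∀ f : FBondY x.toKIdx, bI f = bI ⟨f.src, 0⟩) {c α₀ : ℝ}
    {U : (bg9Y (Matrix (Fin N) (Fin N) ℂ) (specialUnitaryUnits (Fin N)) x).Cfg}
    (hU : (bg9Y (Matrix (Fin N) (Fin N) ℂ) (specialUnitaryUnits (Fin N)) x).Reg335 c α₀ U)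
    {ε : ℝ} (hε : 0 ≤ ε) {ϑ : ℝ} (hϑ : 0 ≤ ϑ)
    (hΘ : ∀ (μ : Fin (d + 1)) (s s' : Site (PV d ℓ x.toKIdx.m x.toKIdx.K hd hL) 0), Adm x.toKIdx ⟨s, μ⟩ ⟨s', μ⟩ →
      tpar x.toKIdx ⟨s, μ⟩ ⟨s', μ⟩ ^ (-ε) * ‖(U μ s : Matrix (Fin N) (Fin N) ℂ) - (U μ s' : Matrix (Fin N) (Fin N) ℂ)‖ ≤ ϑ)
    {δ : ℝ} (hδ : 0 ≤ δ) {R₀ : ℝ} {H₀ : Prop} (μ : Fin (d + 1)) :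
    letI : Fintype (geo9K x.toKIdx).Site := (inferInstance : Fintype (geo9Y x).Site)
    HasMaj (bHS (R := R₀) (H := H₀) x.toKIdx (sIK x.toKIdx bI) ε) (bHK (R := R₀) (H := H₀) x.toKIdx bI ε)
      (JcoKH x.toKIdx (trBasis N) (bg9Y (Matrix (Fin N) (Fin N) ℂ) (specialUnitaryUnits (Fin N)) x) (fun U => U) μ U)
      (fun a a' => (1 + 2 * ϑ + (2 : ℝ) ^ ε) * cR39 (trBasis N) * Real.exp (δ * rJ d ℓ) * Real.exp (-(δ * (geo9Y x).dist a a'))) := by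
  letI : Fintype (geo9K x.toKIdx).Site := (inferInstance : Fintype (geo9Y x).Site)
  exact hasMaj_JcoKH_holder_eps x.toKIdx (trBasis N) (bg9Y (Matrix (Fin N) (Fin N) ℂ) (specialUnitaryUnits (Fin N)) x) (fun U => U)
    hβ1 hbI0 (cfg_norm_le_one_of_reg335 x hU) hε hϑ hΘ hδ μ

omit [NeZero N] [∀ x : MemberY d ℓ hd hL b₀ b₁ Mstar, Fintype (geo9Y x).Site] [∀ x : MemberY d ℓ hd hL b₀ b₁ Mstar, DecidableRel (RelB x.toKIdx)] in
/-- `0 ≤ C_J(ε, ϑ) = (1 + 2ϑ + 2^ε)·cR39·e^{δ·rJ}` for `ε, ϑ ≥ 0`. [cite: Balaban1985BackgroundPropagators, (3.48) p.398, bookkeeping] -/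
theorem constJHε_nonneg (ε : ℝ) {ϑ : ℝ} (hϑ : 0 ≤ ϑ) (δ : ℝ) : 0 ≤ (1 + 2 * ϑ + (2 : ℝ) ^ ε) * cR39 (trBasis N) * Real.exp (δ * rJ d ℓ) := by
  have := cR39_nonneg (trBasis N); have := Real.rpow_nonneg (show (0:ℝ) ≤ 2 by norm_num) ε; positivity

/-- ★★ **`Thm33G0DivR.h44DsDv ε` AT THE PINS FOR EVERY `ε ≥ 0`** (`B9Thm313WholeDvHolderAtPins.h44DsDv_pins` without `ε ≤ 1`): from the directional field `h44Ds · ε`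
(n06-w5's `B9Thm33G0DivRAtPins.h44Ds_pins … μ ε`) and `hasMaj_JcoKH_holder_eps_pins`; `B_dD ≥ (d+1)·B_iD·(1 + 2ϑ + 2^ε)·cR39·e^{δ_J rJ}·c`, `0 ≤ δ₃ ≤ δ₀`, `δ₃ + σ ≤ δ_J` — the
input n06-w5's `thm33G0DivR_of_dir` takes verbatim. [cite: Balaban1985BackgroundPropagators, Thm 3.3 (3.44) p.398 + (3.3) p.390 + (3.35) p.396 + p.398 (remarks after (3.47)); Balaban1984PropagatorsII, (2.26) p.228 + (2.52)–(2.56) pp.232–233 + Lemma 2.1 (2.61) p.234] -/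
theorem h44DsDv_eps_pins (x : MemberY d ℓ hd hL b₀ b₁ Mstar) {bI : FBondY x.toKIdx → IBondY x.toKIdx}
    (hβ1 : ∀ f : FBondY x.toKIdx, (geomT x.D).dist (β x.hN x.D x.hk (bI f)) (blkV1 x.hN x.D f) ≤ 1)
    (hbI0 : ∀ f : FBondY x.toKIdx, bI f = bI ⟨f.src, 0⟩) {c35 α₀ : ℝ}
    {U : (bg9Y (Matrix (Fin N) (Fin N) ℂ) (specialUnitaryUnits (Fin N)) x).Cfg}
    (hU : (bg9Y (Matrix (Fin N) (Fin N) ℂ) (specialUnitaryUnits (Fin N)) x).Reg335 c35 α₀ U)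
    {ε : ℝ} (hε : 0 ≤ ε) {ϑ : ℝ} (hϑ : 0 ≤ ϑ)
    (hΘ : ∀ (μ : Fin (d + 1)) (s s' : Site (PV d ℓ x.toKIdx.m x.toKIdx.K hd hL) 0), Adm x.toKIdx ⟨s, μ⟩ ⟨s', μ⟩ →
      tpar x.toKIdx ⟨s, μ⟩ ⟨s', μ⟩ ^ (-ε) * ‖(U μ s : Matrix (Fin N) (Fin N) ℂ) - (U μ s' : Matrix (Fin N) (Fin N) ℂ)‖ ≤ ϑ)
    {R₀ : ℝ} {H₀ : Prop} (hG : GeoOK (geo9Y x)) {σ c : ℝ} (hrow : RowSum (toB6 (geo9Y x) R₀ H₀) σ c)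
    (𝔬 : Ops (geo9Y x) (bg9Y (Matrix (Fin N) (Fin N) ℂ) (specialUnitaryUnits (Fin N)) x) (XBK (TrIdx N) x.toKIdx) (XBK (TrIdx N) x.toKIdx)
      (XHK (TrIdx N) x.toKIdx) (XSK (TrIdx N) x.toKIdx))
    (hDv : 𝔬.Dv U = DvcoKH x.toKIdx (trBasis N) (bg9Y (Matrix (Fin N) (Fin N) ℂ) (specialUnitaryUnits (Fin N)) x) (fun U => U) U)
    {Dds : Fin (d + 1) → Module.End ℝ (XBK (TrIdx N) x.toKIdx → ℝ)}
    (hDds : Dds = fun μ => coordOpK (trBasis N) (fun _ : Fin (d + 1) => cdsBₗ x.toKIdx U μ))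
    {BiD δ₀ δJ BdD δ₃ : ℝ} (hBiD : 0 ≤ BiD) (hδJ : 0 ≤ δJ) (hδ₃ : 0 ≤ δ₃) (hδ₃0 : δ₃ ≤ δ₀) (hδ₃J : δ₃ + σ ≤ δJ)
    (hBdD : ((d : ℝ) + 1) * (1 * BiD * ((1 + 2 * ϑ + (2 : ℝ) ^ ε) * cR39 (trBasis N) * Real.exp (δJ * rJ d ℓ)) * c) ≤ BdD)
    (h44Ds : ∀ μ, letI : Fintype (geo9K x.toKIdx).Site := (inferInstance : Fintype (geo9Y x).Site)
      HasMaj (bHK (κ := TrIdx N) (R := R₀) (H := H₀) x.toKIdx bI ε) (cNormR R₀ H₀ 𝔬.blkW hG.lenle 0) (𝔬.Dvstar U ∘ₗ (𝔬.G0 U ∘ₗ Dds μ))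
        (fun a b => BiD * Real.exp (-(δ₀ * (geo9Y x).dist a b)))) :
    letI : Fintype (geo9K x.toKIdx).Site := (inferInstance : Fintype (geo9Y x).Site)
    HasMaj (bHS (κ := TrIdx N) (R := R₀) (H := H₀) x.toKIdx (sIK x.toKIdx bI) ε) (cNormR R₀ H₀ 𝔬.blkW hG.lenle 0) (𝔬.Dvstar U ∘ₗ (𝔬.G0 U ∘ₗ 𝔬.Dv U))
      (fun a b => BdD * Real.exp (-(δ₃ * (geo9Y x).dist a b))) := by
  letI : Fintype (geo9K x.toKIdx).Site := (inferInstance : Fintype (geo9Y x).Site)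
  have hDv' : 𝔬.Dv U = ∑ μ, Dds μ ∘ₗ JcoKH x.toKIdx (trBasis N) (bg9Y (Matrix (Fin N) (Fin N) ℂ) (specialUnitaryUnits (Fin N)) x) (fun U => U) μ U := by
    rw [hDv, hDds]
    exact DvcoKH_eq_sum x.toKIdx (trBasis N) (bg9Y (Matrix (Fin N) (Fin N) ℂ) (specialUnitaryUnits (Fin N)) x) (fun U => U) U
  have hJ : ∀ μ, HasMaj (bHS (κ := TrIdx N) (R := R₀) (H := H₀) x.toKIdx (sIK x.toKIdx bI) ε) (bHK (κ := TrIdx N) (R := R₀) (H := H₀) x.toKIdx bI ε)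
      (JcoKH x.toKIdx (trBasis N) (bg9Y (Matrix (Fin N) (Fin N) ℂ) (specialUnitaryUnits (Fin N)) x) (fun U => U) μ U)
      (fun a b => (1 + 2 * ϑ + (2 : ℝ) ^ ε) * cR39 (trBasis N) * Real.exp (δJ * rJ d ℓ) * Real.exp (-(δJ * (geo9Y x).dist a b))) := fun μ =>
    hasMaj_JcoKH_holder_eps_pins x hβ1 hbI0 hU hε hϑ hΘ hδJ μ
  have hBdD' : (Fintype.card (Fin (d + 1)) : ℝ) * ((bHK (κ := TrIdx N) (R := R₀) (H := H₀) x.toKIdx bI ε).κ * BiD *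
      ((1 + 2 * ϑ + (2 : ℝ) ^ ε) * cR39 (trBasis N) * Real.exp (δJ * rJ d ℓ)) * c) ≤ BdD := by
    rw [Fintype.card_fin, Nat.cast_add, Nat.cast_one]
    exact hBdD
  exact h44DsDv_of_h44Ds hG hrow hBiD (constJHε_nonneg ε hϑ δJ) hδ₃ hδ₃0 hδ₃J hBdD' hDv' h44Ds hJ

end Members

end Literature.MathematicalPhysics.QuantumFieldTheory.Balaban1983to89.B9GradViaDivLettersAtPinsHolderEps

end
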